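import Summits.CriticalPhenomena.CardyFormulaZ2.Theorems.CardyMagicRigidityNestingRigidityNeckZ2CoveringAClusters
import HarnessLib

/-!
# Crux `NestingRigidity`, line `pinch-resampling` (v4), stub S12: the `𝔄`-error as a NECKLACE of distinct open clusters (chain form of the covering lemma)

Crux `Summit.CriticalPhenomena.CardyFormulaZ2.Theses.CardyMagicRigidity.NestingRigidity`
(stmt-CriticalPhenomena-4835), line `pinch-resampling` v4, stub S12 `stub_neckHookupCoarseZ2 : NeckHookupCoarseZ2`.
Sequel of `…NeckZ2CoveringAClusters` (worker W1 of wave 5).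

**The intrinsic structure of the `𝔄`-error.**  For a re-connecting family `F` of virtual edges every edge of which
is needed (`…CoveringAClusters`, §1–§2: the `b`-sides `S_e` are nested), the sides are moreover pairwise DISTINCT,
so `F` is linearly ordered by `S_e` (rank `rk e = |S_e|`); every edge has an inner endpoint `inP e ∈ S_e` and an
outer endpoint `outP e ∉ S_e`; and the open clusters of `Λ_{2s}(x)` met along the order form a necklace:

* `b` is joined by an open path of `Λ_{2s}(x)` to `inP e_min`, `outP e` to `inP e'` for CONSECUTIVE `e < e'`, and
  `outP e_max` to `b'` (`pathIn_inP_of_isMin`, `pathIn_outP_inP_of_covBy`, `pathIn_outP_of_isMax`);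
* these clusters are pairwise distinct: `b ≁ outP e`, and `outP e ≁ outP e'` for `e < e'`
  (`not_pathIn_b_outP`, `not_pathIn_outP_outP_of_lt`).

With `F ⊆ zVEdges` (each locale `e.2 ∈ {inP e, outP e}` lies in a blob of sup-diameter `≥ lam`) this is the input of
the certified summation of the `𝔄`-error: a SEQUENCE of junction cells; interval nodes `[e_i … e_j]` whose four-arm
events are governed by the two ADJACENT clusters only (both reach the neighbouring junctions, `≥ lam/2` if big, the
end clusters reach the outer layer) — no `F`-free shells, hence no invisible non-lacunary backgrounds; and pairwise
vertex-disjoint clusters for van den Berg–Kesten/Reimer (`reimer_holds`) at resolution `ℓ`, which pays every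
junction `(α/2)·log(lam/2ℓ)` nats against a hop entropy `log(2δ/ℓ)`.  §3 exports it (`zCovering_A_chain`, anchor).
-/

noncomputable section

namespace Summit.CriticalPhenomena.CardyFormulaZ2.Cruxes.NestingRigidity.PinchResampling

open MeasureTheory Set Literature.Probability.Percolation Literature.Probability.LatticeModels
open ZPinchLocality

namespace NeckCoarseZ2

variable {s : ℕ} {x : Site 2} {ω : BondConfig (Site 2)}

/-! ## §1 Sides are distinct; inner and outer endpoints -/

/-- The `b`-side of the virtual edge `e`: the points chained to `b` over `F ∖ {e}`. -/
def side (s : ℕ) (x : Site 2) (ω : BondConfig (Site 2)) (F : Set (Site 2 × Site 2)) (b : Site 2)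
    (e : Site 2 × Site 2) : Set (Site 2) :=
  {v | Relation.ReflTransGen (fun a c ↦ (a, c) ∈ zAugSteps s x ω (F \ {e})) b v}

/-- Membership in a side. -/
@[simp] theorem mem_side {F : Set (Site 2 × Site 2)} {b : Site 2} {e : Site 2 × Site 2} {v : Site 2} :
    v ∈ side s x ω F b e ↔ Relation.ReflTransGen (fun a c ↦ (a, c) ∈ zAugSteps s x ω (F \ {e})) b v := Iff.rfl

variable {F : Set (Site 2 × Site 2)} {b b' : Site 2}

/-- **The sides of two distinct needed edges are distinct.** -/
theorem side_ne_side (hconn : Relation.ReflTransGen (fun a c ↦ (a, c) ∈ zAugSteps s x ω F) b b')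
    {e e' : Site 2 × Site 2} (he : b' ∉ side s x ω F b e) (he' : b' ∉ side s x ω F b e') (hne : e ≠ e') :
    side s x ω F b e ≠ side s x ω F b e' := by
  intro hS
  obtain ⟨y, z, hy, hz, hyz, -⟩ := zAugChain_exists_step_out (P := side s x ω F b e) hconn
    Relation.ReflTransGen.refl he
  have hor := step_eq_of_exit hyz hy hz
  rw [hS] at hy hz
  have hor' := step_eq_of_exit hyz hy hz
  have h1 := ne_swap_of_needed hconn he he' hne
  have h2 := ne_swap_of_needed hconn he' he hne.symm
  rcases hor with h | h <;> rcases hor' with h' | h'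
  · exact hne (h.symm.trans h')
  · exact h1 (by rw [← h', ← h])
  · exact h2 (by rw [← h, ← h'])
  · exact hne (h.symm.trans h')

/-- **Inner and outer endpoints**: a needed edge has one endpoint in its side and the other outside. -/
theorem exists_endpoints (hconn : Relation.ReflTransGen (fun a c ↦ (a, c) ∈ zAugSteps s x ω F) b b')
    {e : Site 2 × Site 2} (he : b' ∉ side s x ω F b e) :
    ∃ y z, ((y, z) = e ∨ (z, y) = e) ∧ y ∈ side s x ω F b e ∧ z ∉ side s x ω F b e := by
  obtain ⟨y, z, hy, hz, hyz, -⟩ := zAugChain_exists_step_out (P := side s x ω F b e) hconn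
    Relation.ReflTransGen.refl he
  exact ⟨y, z, step_eq_of_exit hyz hy hz, hy, hz⟩

/-- An edge of `F`, in either orientation, is a step of the augmentation by `F`. -/
theorem step_of_endpoints {e : Site 2 × Site 2} (heF : e ∈ F) {y z : Site 2} (hor : (y, z) = e ∨ (z, y) = e) :
    (y, z) ∈ zAugSteps s x ω F := by
  rcases hor with h | h
  · exact Or.inr (Or.inl (h ▸ heF))
  · exact Or.inr (Or.inr (h ▸ heF))

/-- The outer endpoint of `e` lies in the side of every other needed edge `e'` whose side contains that of `e`. -/
theorem out_mem_side (hconn : Relation.ReflTransGen (fun a c ↦ (a, c) ∈ zAugSteps s x ω F) b b')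
    {e e' : Site 2 × Site 2} (he : b' ∉ side s x ω F b e) (he' : b' ∉ side s x ω F b e') (hne : e ≠ e')
    (hS : side s x ω F b e ⊆ side s x ω F b e') {y z : Site 2} (hor : (y, z) = e ∨ (z, y) = e)
    (hy : y ∈ side s x ω F b e) : z ∈ side s x ω F b e' :=
  Relation.ReflTransGen.tail (hS hy)
    (step_mem_diff_of_needed hconn he he' hne (step_of_endpoints (mem_of_needed hconn he) hor) hor)

/-- The inner endpoint of `e'` lies outside the side of every other needed edge `e` whose side is contained in that
of `e'`. -/
theorem in_not_mem_side (hconn : Relation.ReflTransGen (fun a c ↦ (a, c) ∈ zAugSteps s x ω F) b b')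
    {e e' : Site 2 × Site 2} (he : b' ∉ side s x ω F b e) (he' : b' ∉ side s x ω F b e') (hne : e' ≠ e)
    (hS : side s x ω F b e ⊆ side s x ω F b e') {y z : Site 2} (hor : (y, z) = e' ∨ (z, y) = e')
    (hz : z ∉ side s x ω F b e') : y ∉ side s x ω F b e := fun hy ↦
  hz (hS (Relation.ReflTransGen.tail hy
    (step_mem_diff_of_needed hconn he' he hne (step_of_endpoints (mem_of_needed hconn he') hor) hor)))

/-! ## §2 The necklace of open clusters -/

/-- **Last exit**: a chain over `G` from a point of `P` to a point outside `P` has a last step leaving `P`, after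
which it stays outside `P`. -/
theorem exists_last_exit {G : Set (Site 2 × Site 2)} {P : Set (Site 2)} {a v : Site 2}
    (h : Relation.ReflTransGen (fun a c ↦ (a, c) ∈ zAugSteps s x ω G) a v) (ha : a ∈ P) (hv : v ∉ P) :
    ∃ y z, y ∈ P ∧ z ∉ P ∧ (y, z) ∈ zAugSteps s x ω G ∧
      Relation.ReflTransGen (fun a c ↦ (a, c) ∈ zAugSteps s x ω G) a y ∧
      Relation.ReflTransGen (fun p q ↦ (p, q) ∈ zAugSteps s x ω G ∧ p ∉ P ∧ q ∉ P) z v := by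
  induction h with
  | refl => exact (hv ha).elim
  | @tail y z hay hyz ih =>
    by_cases hy : y ∈ P
    · exact ⟨y, z, hy, hv, hyz, hay, Relation.ReflTransGen.refl⟩
    · obtain ⟨y', z', hy', hz', hs, hc, hrest⟩ := ih hy
      exact ⟨y', z', hy', hz', hs, hc, hrest.tail ⟨hyz, hy, hv⟩⟩

/-- Every chain from `a` is a chain all of whose points are chained to `a`. -/
theorem zAugChain_restrict {G : Set (Site 2 × Site 2)} {a v : Site 2}
    (h : Relation.ReflTransGen (fun a c ↦ (a, c) ∈ zAugSteps s x ω G) a v) :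
    Relation.ReflTransGen (fun p q ↦ (p, q) ∈ zAugSteps s x ω G ∧
      ¬ ¬ Relation.ReflTransGen (fun a c ↦ (a, c) ∈ zAugSteps s x ω G) a p ∧
      ¬ ¬ Relation.ReflTransGen (fun a c ↦ (a, c) ∈ zAugSteps s x ω G) a q) a v := by
  induction h with
  | refl => exact Relation.ReflTransGen.refl
  | @tail y z hay hyz ih => exact ih.tail ⟨hyz, not_not_intro hay, not_not_intro (hay.tail hyz)⟩

/-- **Real bands**: a chain over `G` staying outside `P`, all of whose steps outside `P` are real open edges of
`Λ_{2s}(x)`, is an open path of `Λ_{2s}(x)`. -/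
theorem pathIn_of_restricted {G : Set (Site 2 × Site 2)} {P : Set (Site 2)} {z v : Site 2}
    (h : Relation.ReflTransGen (fun p q ↦ (p, q) ∈ zAugSteps s x ω G ∧ p ∉ P ∧ q ∉ P) z v)
    (hz : z ∈ zBall x (2 * s))
    (hreal : ∀ p q, (p, q) ∈ zAugSteps s x ω G → p ∉ P → q ∉ P → (openGraph ω).Adj p q ∧ q ∈ zBall x (2 * s)) :
    PathIn (openGraph ω) (zBall x (2 * s)) z v := by
  induction h with
  | refl => exact PathIn.refl hz
  | @tail p q _ hpq ih =>
    obtain ⟨hadj, hq⟩ := hreal p q hpq.1 hpq.2.1 hpq.2.2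
    exact ih.tail hadj hq

/-- **Steps of the lowest band are real**: for the edge of smallest side, a step between two points of its side is
a real open edge. -/
theorem real_of_step_below (hconn : Relation.ReflTransGen (fun a c ↦ (a, c) ∈ zAugSteps s x ω F) b b')
    (hneeded : ∀ e ∈ F, b' ∉ side s x ω F b e) {e₀ : Site 2 × Site 2} (he₀ : e₀ ∈ F)
    (hmin : ∀ e ∈ F, side s x ω F b e₀ ⊆ side s x ω F b e) {p q : Site 2}
    (hpq : (p, q) ∈ zAugSteps s x ω (F \ {e₀})) (hp : p ∈ side s x ω F b e₀) :
    (openGraph ω).Adj p q ∧ q ∈ zBall x (2 * s) := by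
  rcases hpq with ⟨hadj, -, hq⟩ | hF | hF
  · exact ⟨hadj, hq⟩
  · -- a forward `e`-step, `e ≠ e₀`: its first endpoint is the inner or the outer one, both impossible
    exfalso
    obtain ⟨heF, hne⟩ := hF
    obtain ⟨y, z, hor, hy, hz⟩ := exists_endpoints hconn (hneeded _ heF)
    have hy₀ := in_not_mem_side hconn (hneeded _ he₀) (hneeded _ heF) hne (hmin _ heF) hor hz
    have hz₀ : z ∉ side s x ω F b e₀ := fun h ↦ hz (hmin _ heF h)
    rcases hor with h | h
    · simp only [Prod.mk.injEq] at h; exact hy₀ (h.1 ▸ hp)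
    · simp only [Prod.mk.injEq] at h; exact hz₀ (h.1 ▸ hp)
  · exfalso
    obtain ⟨heF, hne⟩ := hF
    obtain ⟨y, z, hor, hy, hz⟩ := exists_endpoints hconn (hneeded _ heF)
    have hy₀ := in_not_mem_side hconn (hneeded _ he₀) (hneeded _ heF) hne (hmin _ heF) hor hz
    have hz₀ : z ∉ side s x ω F b e₀ := fun h ↦ hz (hmin _ heF h)
    rcases hor with h | h
    · simp only [Prod.mk.injEq] at h; exact hz₀ (h.2 ▸ hp)
    · simp only [Prod.mk.injEq] at h; exact hy₀ (h.2 ▸ hp)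

/-- **`b` is joined to the inner endpoint of the edge of smallest side.** -/
theorem pathIn_inP_of_isMin (hconn : Relation.ReflTransGen (fun a c ↦ (a, c) ∈ zAugSteps s x ω F) b b')
    (hneeded : ∀ e ∈ F, b' ∉ side s x ω F b e) (hb : b ∈ zBall x (2 * s)) {e₀ : Site 2 × Site 2}
    (he₀ : e₀ ∈ F) (hmin : ∀ e ∈ F, side s x ω F b e₀ ⊆ side s x ω F b e) {y z : Site 2}
    (hy : y ∈ side s x ω F b e₀) (_hor : (y, z) = e₀ ∨ (z, y) = e₀) :
    PathIn (openGraph ω) (zBall x (2 * s)) b y := by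
  have h := zAugChain_restrict hy
  refine pathIn_of_restricted (P := {p | ¬ Relation.ReflTransGen
    (fun a c ↦ (a, c) ∈ zAugSteps s x ω (F \ {e₀})) b p}) h hb fun p q hpq hp _ ↦ ?_
  simp only [mem_setOf_eq, not_not] at hp
  exact real_of_step_below hconn hneeded he₀ hmin hpq hp

/-- Matching two orientations of the same edge: the first endpoint of one is an endpoint of the other. -/
theorem fst_eq_or_of_orient {f : Site 2 × Site 2} {p q y z : Site 2} (h₁ : (p, q) = f ∨ (q, p) = f)
    (h₂ : (y, z) = f ∨ (z, y) = f) : y = p ∨ y = q := by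
  rcases h₁ with rfl | rfl <;> rcases h₂ with h | h <;> simp only [Prod.mk.injEq] at h
  exacts [Or.inl h.1, Or.inr h.2, Or.inr h.1, Or.inl h.2]

/-- **Steps above the highest side are real**: for the edge of largest side, a step of the full augmentation between
two points outside its side is a real open edge. -/
theorem real_of_step_above (hconn : Relation.ReflTransGen (fun a c ↦ (a, c) ∈ zAugSteps s x ω F) b b')
    (hneeded : ∀ e ∈ F, b' ∉ side s x ω F b e) {e₁ : Site 2 × Site 2}
    (hmax : ∀ e ∈ F, side s x ω F b e ⊆ side s x ω F b e₁) {p q : Site 2}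
    (hpq : (p, q) ∈ zAugSteps s x ω F) (hp : p ∉ side s x ω F b e₁) (hq : q ∉ side s x ω F b e₁) :
    (openGraph ω).Adj p q ∧ q ∈ zBall x (2 * s) := by
  -- an `f`-step, `f ∈ F`, has its inner endpoint (if `f = e₁`) or both endpoints (if `f ≠ e₁`) in `S_{e₁}`
  have key : ∀ f ∈ F, ((p, q) = f ∨ (q, p) = f) → False := by
    intro f hfF hpq'
    obtain ⟨y, z, hor, hy, hz⟩ := exists_endpoints hconn (hneeded _ hfF)
    have hy₁ : y ∈ side s x ω F b e₁ := hmax _ hfF hy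
    rcases fst_eq_or_of_orient hpq' hor with rfl | rfl
    · exact hp hy₁
    · exact hq hy₁
  rcases hpq with ⟨hadj, -, hq'⟩ | hF | hF
  · exact ⟨hadj, hq'⟩
  · exact (key _ hF (Or.inl rfl)).elim
  · exact (key _ hF (Or.inr rfl)).elim

/-- **The outer endpoint of the edge of largest side is joined to `b'`.** -/
theorem pathIn_outP_of_isMax (hconn : Relation.ReflTransGen (fun a c ↦ (a, c) ∈ zAugSteps s x ω F) b b')
    (hneeded : ∀ e ∈ F, b' ∉ side s x ω F b e) (hO : ∀ e ∈ F, e.1 ∈ zBall x (2 * s) ∧ e.2 ∈ zBall x (2 * s))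
    {e₁ : Site 2 × Site 2} (he₁ : e₁ ∈ F) (hmax : ∀ e ∈ F, side s x ω F b e ⊆ side s x ω F b e₁) {y z : Site 2}
    (hor : (y, z) = e₁ ∨ (z, y) = e₁) (hy : y ∈ side s x ω F b e₁) (hz : z ∉ side s x ω F b e₁) :
    PathIn (openGraph ω) (zBall x (2 * s)) z b' := by
  obtain ⟨y', z', hy', hz', hs, -, hrest⟩ :=
    exists_last_exit (P := side s x ω F b e₁) hconn (Relation.ReflTransGen.refl) (hneeded _ he₁)
  -- the last exit step is `e₁`, landing at `z`
  have hor' := step_eq_of_exit hs hy' hz'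
  have hzz : z' = z := by
    rcases hor with h | h <;> rcases hor' with h' | h' <;>
      have hh := h.trans h'.symm <;> simp only [Prod.mk.injEq] at hh
    · exact hh.2.symm
    · exact absurd (hh.1 ▸ hy) hz'
    · exact absurd (hh.2 ▸ hy) hz'
    · exact hh.1.symm
  subst hzz
  have hzO : z' ∈ zBall x (2 * s) := by
    rcases hor with h | h
    · exact (h ▸ (hO _ he₁)).2
    · exact (h ▸ (hO _ he₁)).1
  exact pathIn_of_restricted hrest hzO fun p q hpq hp hq ↦ real_of_step_above hconn hneeded hmax hpq hp hq

/-- **Steps of a middle band are real**: for consecutive needed edges `e < e'` (no side strictly in between), a step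
of the augmentation by `F ∖ {e'}` between two points of `S_{e'} ∖ S_e` is a real open edge. -/
theorem real_of_step_between (hconn : Relation.ReflTransGen (fun a c ↦ (a, c) ∈ zAugSteps s x ω F) b b')
    (hneeded : ∀ e ∈ F, b' ∉ side s x ω F b e) {e e' : Site 2 × Site 2} (he' : e' ∈ F)
    (hcov : ∀ e'' ∈ F, side s x ω F b e'' ⊆ side s x ω F b e ∨ side s x ω F b e' ⊆ side s x ω F b e'')
    {p q : Site 2} (hpq : (p, q) ∈ zAugSteps s x ω (F \ {e'})) (hp : p ∉ side s x ω F b e)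
    (hp' : p ∈ side s x ω F b e') (hq : q ∉ side s x ω F b e) (hq' : q ∈ side s x ω F b e') :
    (openGraph ω).Adj p q ∧ q ∈ zBall x (2 * s) := by
  have key : ∀ f ∈ F, f ≠ e' → ((p, q) = f ∨ (q, p) = f) → False := by
    intro f hfF hne' hpq'
    obtain ⟨y, z, hor, hy, hz⟩ := exists_endpoints hconn (hneeded _ hfF)
    rcases hcov _ hfF with hle | hle
    · -- side below `S_e`: the inner endpoint is in `S_e`
      have hy₁ : y ∈ side s x ω F b e := hle hy
      rcases fst_eq_or_of_orient hpq' hor with rfl | rfl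
      · exact hp hy₁
      · exact hq hy₁
    · -- side above `S_{e'}`: the inner endpoint is outside `S_{e'}`
      have hy₁ : y ∉ side s x ω F b e' := in_not_mem_side hconn (hneeded _ he') (hneeded _ hfF) hne' hle hor hz
      rcases fst_eq_or_of_orient hpq' hor with rfl | rfl
      · exact hy₁ hp'
      · exact hy₁ hq'
  rcases hpq with ⟨hadj, -, hqO⟩ | ⟨hF, hne'⟩ | ⟨hF, hne'⟩
  · exact ⟨hadj, hqO⟩
  · exact (key _ hF hne' (Or.inl rfl)).elim
  · exact (key _ hF hne' (Or.inr rfl)).elim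

/-- **Consecutive clusters touch**: for consecutive needed edges `e < e'`, the outer endpoint of `e` is joined by an
open path of `Λ_{2s}(x)` to the inner endpoint of `e'`. -/
theorem pathIn_outP_inP_of_covBy (hconn : Relation.ReflTransGen (fun a c ↦ (a, c) ∈ zAugSteps s x ω F) b b')
    (hneeded : ∀ e ∈ F, b' ∉ side s x ω F b e) (hO : ∀ e ∈ F, e.1 ∈ zBall x (2 * s) ∧ e.2 ∈ zBall x (2 * s))
    {e e' : Site 2 × Site 2} (he : e ∈ F) (he' : e' ∈ F) (hne : e ≠ e')
    (hlt : side s x ω F b e ⊆ side s x ω F b e')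
    (hcov : ∀ e'' ∈ F, side s x ω F b e'' ⊆ side s x ω F b e ∨ side s x ω F b e' ⊆ side s x ω F b e'')
    {y z y' z' : Site 2} (hor : (y, z) = e ∨ (z, y) = e) (hy : y ∈ side s x ω F b e) (hz : z ∉ side s x ω F b e)
    (hor' : (y', z') = e' ∨ (z', y') = e') (hy' : y' ∈ side s x ω F b e') (hz' : z' ∉ side s x ω F b e') :
    PathIn (openGraph ω) (zBall x (2 * s)) z y' := by
  -- last exit from `P = S_e ∪ (S_{e'})ᶜ` along a chain `b ⟶ y'` over `F ∖ {e'}`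
  set P : Set (Site 2) := side s x ω F b e ∪ (side s x ω F b e')ᶜ with hP
  have hbP : b ∈ P := Or.inl Relation.ReflTransGen.refl
  have hy'P : y' ∉ P := by
    rintro (h | h)
    · exact in_not_mem_side hconn (hneeded _ he) (hneeded _ he') hne.symm hlt hor' hz' h
    · exact h hy'
  obtain ⟨u, v, huP, hvP, hs, hbu, hrest⟩ := exists_last_exit (P := P) hy' hbP hy'P
  -- the exit step is the `e`-step to `z`
  have hu' : u ∈ side s x ω F b e' := hbu
  have hu : u ∈ side s x ω F b e := huP.resolve_right fun h ↦ h hu'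
  have hv : v ∉ side s x ω F b e := fun h ↦ hvP (Or.inl h)
  have horuv := step_eq_of_exit (zAugSteps_mono' hs) hu hv
  have hvz : v = z := by
    rcases hor with h | h <;> rcases horuv with h' | h' <;>
      have hh := h.trans h'.symm <;> simp only [Prod.mk.injEq] at hh
    · exact hh.2.symm
    · exact absurd (hh.1 ▸ hy) hv
    · exact absurd (hh.2 ▸ hy) hv
    · exact hh.1.symm
  subst hvz
  have hvO : v ∈ zBall x (2 * s) := by
    rcases hor with h | h
    · exact (h ▸ (hO _ he)).2
    · exact (h ▸ (hO _ he)).1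
  refine pathIn_of_restricted hrest hvO fun p q hpq hp hq ↦ ?_
  simp only [hP, mem_union, mem_compl_iff, not_or, not_not] at hp hq
  exact real_of_step_between hconn hneeded he' hcov hpq hp.1 hp.2 hq.1 hq.2
where
  /-- Steps over a sub-family are steps over the family. -/
  zAugSteps_mono' {G : Set (Site 2 × Site 2)} {e' : Site 2 × Site 2} {p : Site 2 × Site 2}
      (h : p ∈ zAugSteps s x ω (G \ {e'})) : p ∈ zAugSteps s x ω G := by
    rcases h with h | h | h
    · exact Or.inl h
    · exact Or.inr (Or.inl h.1)
    · exact Or.inr (Or.inr h.1)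

/-- **Distinct clusters, I**: `b` is not joined to any outer endpoint. -/
theorem not_pathIn_b_outP {e : Site 2 × Site 2} {z : Site 2} (hz : z ∉ side s x ω F b e) :
    ¬ PathIn (openGraph ω) (zBall x (2 * s)) b z := fun h ↦
  hz ((zAugChain_iff_of_pathIn (F \ {e}) h).1 Relation.ReflTransGen.refl)

/-- **Distinct clusters, II**: for needed `e ≠ e'` with `S_e ⊆ S_{e'}`, the outer endpoints of `e` and `e'` are not
joined. -/
theorem not_pathIn_outP_outP_of_lt (hconn : Relation.ReflTransGen (fun a c ↦ (a, c) ∈ zAugSteps s x ω F) b b')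
    {e e' : Site 2 × Site 2} (he : b' ∉ side s x ω F b e) (he' : b' ∉ side s x ω F b e') (hne : e ≠ e')
    (hS : side s x ω F b e ⊆ side s x ω F b e') {y z z' : Site 2} (hor : (y, z) = e ∨ (z, y) = e)
    (hy : y ∈ side s x ω F b e) (hz' : z' ∉ side s x ω F b e') :
    ¬ PathIn (openGraph ω) (zBall x (2 * s)) z z' := fun h ↦
  hz' ((zAugChain_iff_of_pathIn (F \ {e'}) h).1 (out_mem_side hconn he he' hne hS hor hy))

/-! ## §3 Ranks and the covering lemma in chain form -/

/-- Sides lie inside `{b} ∪ Λ_{2s}(x)` (hence are finite), if the edges of `F` have their endpoints in `Λ_{2s}(x)`. -/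
theorem side_subset_insert (hO : ∀ e ∈ F, e.1 ∈ zBall x (2 * s) ∧ e.2 ∈ zBall x (2 * s)) (e : Site 2 × Site 2) :
    side s x ω F b e ⊆ insert b (zBall x (2 * s)) := by
  intro v hv
  induction hv with
  | refl => exact mem_insert _ _
  | @tail y z _ hyz _ =>
    refine mem_insert_of_mem _ ?_
    rcases hyz with ⟨-, -, hz⟩ | hF | hF
    · exact hz
    · exact (hO _ hF.1).2
    · exact (hO _ hF.1).1

/-- **Ranks order the sides**: for needed edges, `|S_e| ≤ |S_{e'}|` iff `S_e ⊆ S_{e'}`. -/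
theorem side_subset_iff_ncard_le (hconn : Relation.ReflTransGen (fun a c ↦ (a, c) ∈ zAugSteps s x ω F) b b')
    (hO : ∀ e ∈ F, e.1 ∈ zBall x (2 * s) ∧ e.2 ∈ zBall x (2 * s)) {e e' : Site 2 × Site 2}
    (he : b' ∉ side s x ω F b e) (he' : b' ∉ side s x ω F b e') :
    side s x ω F b e ⊆ side s x ω F b e' ↔ (side s x ω F b e).ncard ≤ (side s x ω F b e').ncard := by
  have hfin : ∀ f, (side s x ω F b f).Finite := fun f ↦
    ((zBall_finite x (2 * s)).insert b).subset (side_subset_insert hO f)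
  refine ⟨fun h ↦ ncard_le_ncard h (hfin e'), fun h ↦ ?_⟩
  rcases side_subset_or_subset hconn he he' with h' | h'
  · exact h'
  · exact (eq_of_subset_of_ncard_le h' h (hfin e)).symm.subset

end NeckCoarseZ2

/-- **Covering lemma for `𝔄` on `ℤ²`, chain form (registered helper, anchor of this module on the crux item).**  Under
the hypotheses of `zCovering_A_nodes` there is a nonempty finite family `F ⊆ zVEdges` of virtual edges with the node
property of `zCovering_A_nodes`, a rank `rk`, injective on `F`, and inner/outer endpoints `inP e, outP e` of every
`e ∈ F`, such that the open clusters of `Λ_{2s}(x)` met along the ranks form a NECKLACE: `b` is joined to `inP` of the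
edge of least rank, `outP e` to `inP e'` for rank-consecutive `e, e'`, `outP` of the edge of largest rank to `b'`; and
these clusters are pairwise distinct (`b ≁ outP e`; `outP e ≁ outP e'` for `rk e < rk e'`).  Each locale `e.2` is
`inP e` or `outP e` and lies in a blob of sup-diameter `≥ lam` (`F ⊆ zVEdges`). -/
theorem zCovering_A_chain : ∀ (ℓ lam s : ℕ) (x o : Site 2) (ω : BondConfig (Site 2)), (∀ a b, (openGraph ω).Adj a b → (zdGraph 2).Adj a b) → 1 ≤ ℓ → ∀ b b' : Site 2, IsCrossing (zdGraph 2) (openGraph ω) (zBall x s) (zBall x (2 * s)) b → IsCrossing (zdGraph 2) (openGraph ω) (zBall x s) (zBall x (2 * s)) b' → ¬ PathIn (openGraph ω) (zBall x (2 * s)) b b' → Relation.ReflTransGen (fun a c ↦ (a, c) ∈ NeckCoarseZ2.zAugSteps s x ω (NeckCoarseZ2.zVEdges ℓ lam s x o ω)) b b' → ∃ F : Finset (Site 2 × Site 2), ↑F ⊆ NeckCoarseZ2.zVEdges ℓ lam s x o ω ∧ F.Nonempty ∧ (∀ 𝒩 ⊆ F, 𝒩.Nonempty → ∀ (w : Site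 2) (Δ r R Γ : ℕ), w ∈ innerLayer (zdGraph 2) (zBall x s) (zBall x (2 * s)) → (∀ e ∈ 𝒩, zNorm (e.2 - w) ≤ Δ) → (∀ e ∈ F, e ∉ 𝒩 → (Γ : ℤ) ≤ zNorm (e.2 - w)) → Δ + ℓ ≤ r → r ≤ R → R + ℓ ≤ Γ → R + 1 ≤ s → ω ∈ fourArmTwoClustersAt w r R) ∧ ∃ (rk : Site 2 × Site 2 → ℕ) (inP outP : Site 2 × Site 2 → Site 2), Set.InjOn rk ↑F ∧ (∀ e ∈ F, (inP e, outP e) = e ∨ (outP e, inP e) = e) ∧ (∀ e ∈ F, (∀ e' ∈ F, rk e ≤ rk e') → PathIn (openGraph ω) (zBall x (2 * s)) b (inP e)) ∧ (∀ e ∈ F, (∀ e' ∈ F, rk e' ≤ rk e) → PathIn (openGraph ω) (zBall x (2 * s)) (outP e) b') ∧ (∀ e ∈ F, ∀ e' ∈ F, rk e < rk e' → (∀ e'' ∈ F, rk e'' ≤ rk e ∨ rk e' ≤ rk e'') → PathIn (openGraph ω) (zBall x (2 * s)) (outP e) (inP e')) ∧ (∀ e ∈ F, ¬ PathIn (openGraph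 ω) (zBall x (2 * s)) b (outP e)) ∧ (∀ e ∈ F, ∀ e' ∈ F, rk e < rk e' → ¬ PathIn (openGraph ω) (zBall x (2 * s)) (outP e) (outP e')) := by
  intro ℓ lam s x o ω hHG hℓ b b' hb hb' hnR hchain
  obtain ⟨F, hFU', hne, hFchain, hneeded⟩ := NeckCoarseZ2.exists_needed_family hnR hb.1.1.1 hchain
  refine ⟨F, hFU', hne, NeckCoarseZ2.nodes_of_needed hHG hℓ hb hb' hFU' hFchain hneeded, ?_⟩
  have hO : ∀ e ∈ (↑F : Set (Site 2 × Site 2)), e.1 ∈ zBall x (2 * s) ∧ e.2 ∈ zBall x (2 * s) := fun e he ↦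
    NeckCoarseZ2.mem_zBall_of_mem_zVEdges (hFU' he)
  have hnd : ∀ e ∈ (↑F : Set (Site 2 × Site 2)), b' ∉ NeckCoarseZ2.side s x ω ↑F b e := fun e he ↦ hneeded e he
  have key : ∀ e ∈ F, ∃ y z, ((y, z) = e ∨ (z, y) = e) ∧ y ∈ NeckCoarseZ2.side s x ω ↑F b e ∧
      z ∉ NeckCoarseZ2.side s x ω ↑F b e := fun e he ↦ NeckCoarseZ2.exists_endpoints hFchain (hnd e he)
  choose! inP outP hor hin hout using key
  set rk : Site 2 × Site 2 → ℕ := fun e ↦ (NeckCoarseZ2.side s x ω ↑F b e).ncard with hrk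
  have hle : ∀ e ∈ F, ∀ e' ∈ F, rk e ≤ rk e' ↔ NeckCoarseZ2.side s x ω ↑F b e ⊆ NeckCoarseZ2.side s x ω ↑F b e' :=
    fun e he e' he' ↦ (NeckCoarseZ2.side_subset_iff_ncard_le hFchain hO (hnd e he) (hnd e' he')).symm
  have hlt : ∀ e ∈ F, ∀ e' ∈ F, rk e < rk e' →
      NeckCoarseZ2.side s x ω ↑F b e ⊆ NeckCoarseZ2.side s x ω ↑F b e' ∧ e ≠ e' := fun e he e' he' h ↦
    ⟨(hle e he e' he').1 h.le, fun heq ↦ by subst heq; exact lt_irrefl _ h⟩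
  refine ⟨rk, inP, outP, ?_, hor, ?_, ?_, ?_, ?_, ?_⟩
  · intro e he e' he' h
    by_contra hne'
    exact NeckCoarseZ2.side_ne_side hFchain (hnd e he) (hnd e' he') hne'
      (((hle e he e' he').1 h.le).antisymm ((hle e' he' e he).1 h.ge))
  · intro e he hmin
    exact NeckCoarseZ2.pathIn_inP_of_isMin hFchain hnd hb.1.1.1 he (fun e' he' ↦ (hle e he e' he').1 (hmin e' he'))
      (hin e he) (hor e he)
  · intro e he hmax
    exact NeckCoarseZ2.pathIn_outP_of_isMax hFchain hnd hO he (fun e' he' ↦ (hle e' he' e he).1 (hmax e' he'))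
      (hor e he) (hin e he) (hout e he)
  · intro e he e' he' h hcov
    obtain ⟨hS, hne'⟩ := hlt e he e' he' h
    refine NeckCoarseZ2.pathIn_outP_inP_of_covBy hFchain hnd hO he he' hne' hS (fun e'' he'' ↦ ?_) (hor e he)
      (hin e he) (hout e he) (hor e' he') (hin e' he') (hout e' he')
    rcases hcov e'' he'' with h'' | h''
    · exact Or.inl ((hle e'' he'' e he).1 h'')
    · exact Or.inr ((hle e' he' e'' he'').1 h'')
  · exact fun e he ↦ NeckCoarseZ2.not_pathIn_b_outP (hout e he)
  · intro e he e' he' h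
    obtain ⟨hS, hne'⟩ := hlt e he e' he' h
    exact NeckCoarseZ2.not_pathIn_outP_outP_of_lt hFchain (hnd e he) (hnd e' he') hne' hS (hor e he) (hin e he)
      (hout e' he')

end Summit.CriticalPhenomena.CardyFormulaZ2.Cruxes.NestingRigidity.PinchResampling

end
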